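import Mathlib
import HarnessLib
import Summits.HodgeConjecture.Statement
import Summits.HodgeConjecture.HodgeConjecture.Theses.CyclicUnitaryPowers
import Literature.AlgebraicGeometry.Motives.HodgeTensor
import Literature.AlgebraicGeometry.Motives.HodgeTensorFactsHolds
import Literature.AlgebraicGeometry.Motives.FibrePowerSmoothProjective
import Literature.AlgebraicGeometry.Motives.PeriodRealizationClassical
import Literature.AlgebraicGeometry.HodgeTheory.HodgeConjecture
import Literature.AlgebraicGeometry.HodgeTheory.BettiUniverseAxioms
import Literature.AlgebraicGeometry.HodgeTheory.BettiUniverseTracePairing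
import Literature.AlgebraicGeometry.HodgeTheory.ComplexConjugationHolds
import Literature.AlgebraicGeometry.HodgeTheory.HodgeFiltrationModelsReductionProofs
import Literature.AlgebraicGeometry.HodgeTheory.HodgeStructureOfHodgeModel
import Literature.AlgebraicGeometry.HodgeTheory.RealStructureSingular
import Literature.AlgebraicGeometry.HodgeTheory.AlgebraicClassesPullback
import Literature.AlgebraicGeometry.HodgeTheory.BettiUniverseKunnethHodgePowersInsert
import Literature.AlgebraicGeometry.Motives.MumfordTateGroupTensorSpacePoints
import Summits.HodgeConjecture.HodgeConjecture.Theorems.CyclicUnitaryPowersEigenHodgeNumbersAffine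
import Summits.HodgeConjecture.HodgeConjecture.Theorems.CyclicUnitaryPowersTraceFormHodgeOrthogonal
import Summits.HodgeConjecture.HodgeConjecture.Theorems.CyclicUnitaryPowersSummandHodgeNormalFormSurface
import Summits.HodgeConjecture.HodgeConjecture.Theorems.CyclicUnitaryPowersDeckUnitaryCayleyAscent
import Summits.HodgeConjecture.HodgeConjecture.Theorems.CyclicUnitaryPowersDeckUnitaryCommutatorGeneration
import Summits.HodgeConjecture.HodgeConjecture.Theorems.CyclicUnitaryPowersUnitaryTorusLemma
import Summits.HodgeConjecture.HodgeConjecture.Theorems.CyclicUnitaryPowersDeckUnitaryInvariantsMatching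
import Summits.HodgeConjecture.HodgeConjecture.Theorems.CyclicUnitaryPowersMatchingClassesAlgebraicCyclic
import Summits.HodgeConjecture.HodgeConjecture.Theorems.BoundaryReadoutPullbackAlgebraic

/-!
# Route `CyclicUnitaryPowers`, crux K2 `PowersHodgeOfDeckCommutators` (stmt-HodgeConjecture-19545) — CLOSING COMPOSITION

The registered skeleton `unitary-kunneth-fft` v6 (sha16 `e821e1634d2d5d3d`, HOME/p3/k2lineA-v6-g23/) of the rank-3 crux
`Summit.HodgeConjecture.HodgeConjecture.Theses.CyclicUnitaryPowers.PowersHodgeOfDeckCommutators` has every THEOREM stub of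
its lane 2 landed BY NAME under `Theorems/`:

* D₁ `stub_deckUnitaryCommutatorAscent` (`CyclicUnitaryPowersDeckUnitaryCayleyAscent`, p534578) — Cayley ascent of
  commutator invariance from `ℚ`-points to `ℂ`-points;
* D₂ `stub_deckUnitaryCommutatorGeneration` (`CyclicUnitaryPowersDeckUnitaryCommutatorGeneration`, p542072) — such
  commutators generate the derived deck-unitary group `D(U)(ℂ) = Π_j SL(V_j)`;
* T `stub_unitaryTorusLemma` (`CyclicUnitaryPowersUnitaryTorusLemma`, p549630) — the lever: for a HODGE tensor,
  `D(U)(ℂ)`-invariance upgrades to invariance under the connected deck-unitary group `U⁰(ℂ)` (Deligne torus, affine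
  eigen-Hodge offsets = landed W `stub_eigenHodgeNumbersAffine` p515701, Galois spreading, `DetSupportsBalanced`);
* L `stub_deckUnitaryInvariantsMatching` (`CyclicUnitaryPowersDeckUnitaryInvariantsMatching`, p554589) — `GL`-type first
  fundamental theorem: `U⁰(ℂ)`-invariant rational tensors are `ℚ`-combinations of cyclic matching tensors;
* KS `stub_summandHodgeNormalFormSurface` (`CyclicUnitaryPowersSummandHodgeNormalFormSurface`, p520523) and
  G `stub_traceFormHodgeOrthogonal` (`CyclicUnitaryPowersTraceFormHodgeOrthogonal`, p514268) — Künneth–Hodge normal form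
  per tensor summand of `H^{2q}(X^{k+1})`, and `F³H²(X) = 0` / Hodge–Riemann orthogonality of `tr ∘ cup`;
* A `stub_matchingClassesAlgebraicCyclic` (`CyclicUnitaryPowersMatchingClassesAlgebraicCyclic`) — Künneth insertions of
  cyclic matching tensors have algebraic complexification.

The only remaining binder of the skeleton is the named Literature FACT
`Literature.AlgebraicGeometry.HodgeTheory.fulton1998_map_mem_algebraicClasses` (Fulton 1998, Cor. 19.2 (b): pull-backs of
algebraic classes are algebraic; skeleton binder `stub_fultonPullback`), which is the tree THEOREM
`Summit.HodgeConjecture.HodgeConjecture.Theorems.fulton1998_map_mem_algebraicClasses_holds`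
(`Theorems/BoundaryReadoutPullbackAlgebraic`).  This file is the skeleton's kernel-checked composition
(`PowersHodgeOfDeckCommutators_of` fed by `unitaryHodgeTensorFFT_of_DTL` and `deckUnitaryCommutatorDensity_of_D12`)
with the landed theorems substituted: `powersHodgeOfDeckCommutators_of_fulton` proves the crux BY NAME from the
Fulton fact as a hypothesis, and `powersHodgeOfDeckCommutators` discharges it.  No new mathematics.

Proof outline (the line): a rational Hodge class on the fibre power `Y = X^{k+1}` of the smooth `p`-cyclic surface
`X : x₃^p = f` is a sum over Künneth summands (`exists_eq_sum_fanKunnethMap_powInsert_of_mem_hodgeClasses`), each in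
the span of decorated Künneth insertions `E t` of Hodge tensors `t ∈ T^{r,0}H²(X; ℚ)` (KS); a Hodge tensor is fixed by
every commutator of deck-unitary `ℚ`-automorphisms (hypothesis `Comm`: those commutators lie in the Hodge group, which
fixes Hodge tensors by definition), hence by `D(U)(ℂ)` (D₁, D₂), hence by `U⁰(ℂ)` (T, using the Hodge condition, W,
G and the balanced-support hypothesis), hence is a `ℚ`-combination of cyclic matching tensors (L), whose insertions
are algebraic (A, P).

## References

* J. Carlson, D. Toledo, *Discriminant complements and kernels of monodromy representations*, Duke Math. J. 97
  (1999). [cite: CarlsonToledo1999]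
* J. J. Ramón Marí, *On the Hodge conjecture for products of certain surfaces*, Collect. Math. 59 (2008), Thm. 3.3.
  [cite: RamonMari2008]
* R. Goodman, N. Wallach, *Symmetry, Representations, and Invariants*, GTM 255, Thm. 5.2.1 / §5.3.
  [cite: GoodmanWallachGTM255]
* W. Fulton, *Intersection Theory* (1998), §19.2 Cor. 19.2 (b). [cite: Fulton1998]
-/

-- `Summit.HodgeConjecture.HodgeConjecture.Theorems` is the mandated namespace (single-problem summit), which
-- `linter.dupNamespace` flags; the lakefile turns the linter off tree-wide, restated here for stand-alone checks.
set_option linter.dupNamespace false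

noncomputable section

open Literature.AlgebraicGeometry.Motives Literature.AlgebraicGeometry.HodgeTheory
open Literature.AlgebraicGeometry.HodgeTheory.BettiUniverse
open Literature.AlgebraicTopology.SingularHomology
open CategoryTheory CategoryTheory.Limits
open scoped TensorProduct PiTensorProduct BigOperators

namespace Summit.HodgeConjecture.HodgeConjecture.Theorems.CyclicUnitaryPowersPowersHodgeOfDeckCommutators

/-- **Crux K2 `PowersHodgeOfDeckCommutators` modulo the Fulton pull-back fact** (the skeleton's lane-2 composition
with every stub a landed theorem): for every prime `p ≥ 7` at which Galois-stable determinant supports are balanced,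
every smooth `p`-cyclic surface `X ⊂ ℙ³` carrying a deck-type `σ` all of whose deck-unitary commutators lie in the
Hodge group satisfies the Hodge conjecture on all self fibre powers `X^{k+1}`.
[cite: RamonMari2008, Thm. 3.3] [cite: GoodmanWallachGTM255, Thm. 5.2.1]
[cite: Fulton1998, §19.2 Cor. 19.2 (b)] -/
theorem powersHodgeOfDeckCommutators_of_fulton
    (hP : Literature.AlgebraicGeometry.HodgeTheory.fulton1998_map_mem_algebraicClasses) :
    Summit.HodgeConjecture.HodgeConjecture.Theses.CyclicUnitaryPowers.PowersHodgeOfDeckCommutators := by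
  have hW := @CyclicUnitaryPowersEigenHodgeNumbersAffine.stub_eigenHodgeNumbersAffine
  have hG := @CyclicUnitaryPowersTraceFormHodgeOrthogonal.stub_traceFormHodgeOrthogonal
  have hKS := @CyclicUnitaryPowersSummandHodgeNormalFormSurface.stub_summandHodgeNormalFormSurface
  have hD1 := @CyclicUnitaryPowersDeckUnitaryCayleyAscent.stub_deckUnitaryCommutatorAscent
  have hD2 := @CyclicUnitaryPowersDeckUnitaryCommutatorGeneration.stub_deckUnitaryCommutatorGeneration
  have hT := @CyclicUnitaryPowersUnitaryTorusLemma.stub_unitaryTorusLemma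
  have hL := @CyclicUnitaryPowersDeckUnitaryInvariantsMatching.stub_deckUnitaryInvariantsMatching
  have hA := @CyclicUnitaryPowersMatchingClassesAlgebraicCyclic.stub_matchingClassesAlgebraicCyclic
  intro p hp h7 hBal X hX hf hσ k Y hY
  obtain ⟨π, ⟨hlim⟩⟩ := hY
  obtain ⟨σ, hDeck, hComm⟩ := hσ
  obtain ⟨hsp, hsQ, hfix, ζ, hζ, hnum⟩ := hDeck
  haveI hfin : Module.Finite ℚ (bettiCohomology X 2) := finite hX 2
  haveI hTF : HodgeTensorFacts.{0, 0} := hodgeTensorFacts_holds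
  have hYsp : IsSmoothProjective (2 * (k + 1)) Y := isSmoothProjective_of_isLimit_fan hX π hlim
  refine ⟨⟨realHodgeModel exists_isReal_hodgeModel_holds hYsp⟩, ?_⟩
  intro q c hrat hqq
  obtain ⟨v, rfl⟩ := (isRationalClass_iff_mem_range_ofRatClass c).1 hrat
  have hv : v ∈ (hodge exists_isReal_hodgeModel_holds hYsp (2 * q)).hodgeClasses q :=
    (HodgeModel.mem_hodgeClasses_iff_isOfHodgeType (realHodgeModel exists_isReal_hodgeModel_holds hYsp) hYsp
      hodgePQ_independent_of_hodgeModel_holds (realHodgeModel_isHodgeSymmetric exists_isReal_hodgeModel_holds hYsp)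
      q v).2 hqq
  -- Künneth–Hodge: `v` is a sum over the tensor summands of Künneth images of summand Hodge classes (brick K-c)
  obtain ⟨xκ, hxκ, rfl⟩ := exists_eq_sum_fanKunnethMap_powInsert_of_mem_hodgeClasses exists_isReal_hodgeModel_holds
    hodgePQ_independent_of_hodgeModel_holds hX π hlim hYsp (q : ℤ) hv
  rw [map_sum]
  refine Submodule.sum_mem _ fun κ _ => ?_
  -- each summand lies in the span of the decorated Künneth insertions `E t` of Hodge tensors (KS)
  have hspan := hKS hP hp h7 hX hf π hlim q κ (xκ κ) (hxκ κ)
  -- the form data on `H²(X, ℚ)`: `Q = tr ∘ cup`, `s = σ^*`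
  have hQn : ((cup X 2 2).compr₂ (tr hX (2 + 2))).Nondegenerate := nondegenerate_tr_cup hX
  have hsQ' : ∀ x y, ((cup X 2 2).compr₂ (tr hX (2 + 2))) (pull σ 2 x) (pull σ 2 y) =
      ((cup X 2 2).compr₂ (tr hX (2 + 2))) x y := fun x y => by
    rw [LinearMap.compr₂_apply, LinearMap.compr₂_apply]; exact hsQ x y
  have hsF : ∀ a : ℤ, ((hodge exists_isReal_hodgeModel_holds hX 2).F a).map ((pull σ 2).baseChange ℂ) ≤
      (hodge exists_isReal_hodgeModel_holds hX 2).F a := fun a =>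
    pull_hodge exists_isReal_hodgeModel_holds hodgePQ_independent_of_hodgeModel_holds hX hX σ 2 a
  -- `tr ∘ cup` on `H²` is symmetric (graded commutativity in even degree)
  have hQsymm : ∀ x y, ((cup X 2 2).compr₂ (tr hX (2 + 2))) x y = ((cup X 2 2).compr₂ (tr hX (2 + 2))) y x :=
    fun x y => by
    rw [LinearMap.compr₂_apply, LinearMap.compr₂_apply]
    have h := bettiCup_gradedComm (cupProduct_gradedComm_holds ℚ (ComplexPoints X))
      (rfl : 2 + 2 = 2 + 2) rfl x y
    have h1 : ((-1 : ℚ) ^ (2 * 2)) = 1 := by norm_num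
    rw [h1, one_smul] at h
    exact congrArg _ h
  -- `F³ H²(X) = 0` (landed with stub G)
  have hF3 : (hodge exists_isReal_hodgeModel_holds hX 2).F 3 = ⊥ :=
    CyclicUnitaryPowersTraceFormHodgeOrthogonal.hodge_F_eq_bot_of_lt exists_isReal_hodgeModel_holds hX 2 (r := 3)
      (by norm_num)
  have hWp := hW p hp h7
  refine Submodule.span_induction (p := fun x _ => ofRatClass (ComplexPoints Y) (2 * q) x ∈ algebraicClasses Y q)
    ?_ ?_ ?_ ?_ hspan
  · rintro x ⟨q', r, u, wdec, hwdec, E, hE, t, ht, rfl⟩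
    -- every Hodge tensor is fixed by the commutators of `Uni`-elements (`Comm` + tensor definition of `Hg`)
    have hinv : ∀ g h : bettiCohomology X 2 ≃ₗ[ℚ] bettiCohomology X 2,
        (∀ x, g (pull σ 2 x) = pull σ 2 (g x)) →
        (∀ x y, ((cup X 2 2).compr₂ (tr hX (2 + 2))) (g x) (g y) = ((cup X 2 2).compr₂ (tr hX (2 + 2))) x y) →
        (∀ x, h (pull σ 2 x) = pull σ 2 (h x)) →
        (∀ x y, ((cup X 2 2).compr₂ (tr hX (2 + 2))) (h x) (h y) = ((cup X 2 2).compr₂ (tr hX (2 + 2))) x y) →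
        tensorSpaceAct (g * h * g⁻¹ * h⁻¹) t = t := by
      intro g h hgs hgQ hhs hhQ
      obtain ⟨p', hp', ht'⟩ := ht
      have hg' : ∀ x y, tr hX (2 + 2) (cup X 2 2 (g x) (g y)) = tr hX (2 + 2) (cup X 2 2 x y) := fun x y => by
        have := hgQ x y; rwa [LinearMap.compr₂_apply, LinearMap.compr₂_apply] at this
      have hh' : ∀ x y, tr hX (2 + 2) (cup X 2 2 (h x) (h y)) = tr hX (2 + 2) (cup X 2 2 x y) := fun x y => by
        have := hhQ x y; rwa [LinearMap.compr₂_apply, LinearMap.compr₂_apply] at this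
      have hmem := hComm g h ⟨hgs, hg'⟩ ⟨hhs, hh'⟩
      exact (HodgeStructure.mem_hodgeGroup_iff _ _).1 hmem r 0 p' hp' t ht'
    -- lane 2: D₁ ⇒ D₂ (invariance under `D(U)(ℂ)`) ⇒ T (invariance under `U⁰(ℂ)`) ⇒ L (matching span)
    have hDens := hD2 (bettiCohomology X 2) ((cup X 2 2).compr₂ (tr hX (2 + 2))) (pull σ 2) p hp (by omega) hQn
      hQsymm hsp hsQ' hfix ζ hζ r t
      (hD1 (bettiCohomology X 2) ((cup X 2 2).compr₂ (tr hX (2 + 2))) (pull σ 2) p hp (by omega) hQn hQsymm hsp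
        hsQ' r t hinv)
    have hTor := hT (bettiCohomology X 2) (hodge exists_isReal_hodgeModel_holds hX 2)
      ((cup X 2 2).compr₂ (tr hX (2 + 2))) (pull σ 2) p _ hp (by omega) hQn hQsymm (hG hX) hsp hsQ' hsF hF3 hfix
      ⟨ζ, hζ, hnum⟩ ⟨(p : ℤ) - 3, by omega, hWp⟩ (hBal hp) ζ hζ r t ht hDens
    have htspan := hL (bettiCohomology X 2) ((cup X 2 2).compr₂ (tr hX (2 + 2))) (pull σ 2) p hp (by omega) hQn
      hQsymm hsp hsQ' hfix r t hTor
    refine Submodule.span_induction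
      (p := fun y _ => ofRatClass (ComplexPoints Y) (2 * q) (E y) ∈ algebraicClasses Y q) ?_ ?_ ?_ ?_ htspan
    · rintro m ⟨j, l, ε, τ, z, hz, rfl⟩
      exact hA hP hp h7 hX hf σ ⟨hsp, hsQ, hfix, ζ, hζ, hnum⟩ π hlim q q' r u wdec hwdec E hE j l ε τ z hz
    · simp
    · intro a b _ _ ha hb
      simpa [map_add] using add_mem ha hb
    · intro a y _ hy
      simpa [map_smul, Literature.AlgebraicGeometry.Motives.ofRatClass_smul] using Submodule.smul_mem _ (a : ℂ) hy
  · simp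
  · intro a b _ _ ha hb
    simpa [map_add] using add_mem ha hb
  · intro a y _ hy
    simpa [Literature.AlgebraicGeometry.Motives.ofRatClass_smul] using Submodule.smul_mem _ (a : ℂ) hy

/-- **Crux K2 `PowersHodgeOfDeckCommutators` (stmt-HodgeConjecture-19545), UNCONDITIONAL**: the Fulton binder of
`powersHodgeOfDeckCommutators_of_fulton` is the tree THEOREM
`Summit.HodgeConjecture.HodgeConjecture.Theorems.fulton1998_map_mem_algebraicClasses_holds`
(`Theorems/BoundaryReadoutPullbackAlgebraic`, crux `PullbackAlgebraic` of route `BoundaryReadout`).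
[cite: Fulton1998, §19.2 Cor. 19.2 (b)] [cite: RamonMari2008, Thm. 3.3] -/
theorem powersHodgeOfDeckCommutators :
    Summit.HodgeConjecture.HodgeConjecture.Theses.CyclicUnitaryPowers.PowersHodgeOfDeckCommutators :=
  powersHodgeOfDeckCommutators_of_fulton
    Summit.HodgeConjecture.HodgeConjecture.Theorems.fulton1998_map_mem_algebraicClasses_holds

end Summit.HodgeConjecture.HodgeConjecture.Theorems.CyclicUnitaryPowersPowersHodgeOfDeckCommutators

end
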